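import Literature.AnabelianGeometry.SemiGraphs.TemperedAnabelianLem63iiProofs
import Literature.AnabelianGeometry.SemiGraphs.TemperedAnabelianSec6OfTowerProofs
import HarnessLib

/-!
# [SemiAnbd] Lemma 6.3 (ii) and Theorem 6.4 for `Π^temp`, from the virtually free tower

Mochizuki, *Semi-graphs of anabelioids*, Publ. RIMS **42** (2006) [SemiAnbd], §6, Lemma 6.3 (ii)
p. 70 and Theorem 6.4 (Tempered Anabelian Theorem for Hyperbolic Curves over Local Fields) pp. 70–71.
[cite: MochizukiSemiAnbd2006, Lem 6.3(ii) p.70; Thm 6.4 pp.70-71]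

PROOF-ONLY companion (abc-iut cell, prover abc-iut-w5-d240; no definitions, no named facts
introduced) of `TemperedAnabelianSec6OfTowerProofs.lean`:

* `TemperedCurve.piTempDFGIffDOF_of_tower` — Lemma 6.3 (ii) (`X.PiTempDFGIffDOF`) under the tower
  input `htower₀` (cofinally many open normal `N ⊴ Π^temp` with `Π^temp/N ⊇` a non-abelian free normal
  subgroup of finite index and finite rank), via `piTempDFGIffDOF_of_virtuallyFreeQuotients`
  (`TemperedAnabelianLem63iiProofs`) and `virtuallyFreeQuotients_of_tower`;
* `TemperedCurve.temperedAnabelianTheorem_of_tower`, `TemperedMorphismOrigin.temperedAnabelianTheoremHolds_of_tower`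
  — [SemiAnbd] Thm. 6.4 (`TemperedAnabelianTheorem C`, in-cone fact `TemperedAnabelianTheoremHolds`)
  modulo {T64-L01/L01b `π₁^temp`-functor clauses, T64-L04 [Mzk8] Thm. 1.2, `IsTempered Y.PiTemp`,
  `htower₀`}: the two Lemma 6.3 rows of the sub-DAG assembly `temperedAnabelianTheorem_of_inputs`
  (abc-iut-w5-d139) are discharged over the tower (`piTempDFGIffDOF_of_tower`,
  `openDenseDOFConjugator_of_tower`).

Classical topological group theory + bookkeeping; nothing here concerns the disputed parts of
inter-universal Teichmüller theory or takes a side on [IUTchIII] Cor. 3.12; typed ≠ discharged.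
-/

noncomputable section

namespace Literature.AnabelianGeometry.SemiGraphs

open _root_.Topology

namespace TemperedCurve

variable {p : ℕ} [Fact p.Prime]

/-- **[SemiAnbd] Lemma 6.3 (ii) for `F = Π^temp_{X_K}`** (the typed node `X.PiTempDFGIffDOF`) under the
tower input `htower₀` (which implies the virtually-free-quotients input of
`piTempDFGIffDOF_of_virtuallyFreeQuotients`). [cite: MochizukiSemiAnbd2006, Lem 6.3(ii) p.70] -/
theorem piTempDFGIffDOF_of_tower (X : TemperedCurve p)
    (htower₀ : ∀ U ∈ 𝓝 (1 : X.PiTemp), ∃ N : OpenNormalSubgroup X.PiTemp, (N : Set X.PiTemp) ⊆ U ∧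
      ∃ (G : Subgroup (X.PiTemp ⧸ N.toSubgroup)) (_ : IsFreeGroup G), G.Normal ∧ G.FiniteIndex ∧
        Finite (IsFreeGroup.Generators G) ∧ ∃ a ∈ G, ∃ b ∈ G, a * b ≠ b * a) :
    X.PiTempDFGIffDOF :=
  X.piTempDFGIffDOF_of_virtuallyFreeQuotients (virtuallyFreeQuotients_of_tower htower₀)

/-! ### Theorem 6.4 under the tower input -/

/-- **[SemiAnbd] Theorem 6.4 (Tempered Anabelian Theorem)** for `C : TemperedCurveHom p X Y`, reduced
to its inputs with the two Lemma 6.3 rows DISCHARGED over the tower: `TemperedAnabelianTheorem C` holds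
given the `π₁^temp`-functor clauses T64-L01 `GeometricIsDFG C` / T64-L01b `GeometricIsGaloisCompatible C`,
T64-L04 = [Mzk8] Thm. 1.2 `ProfiniteAnabelianTheorem C`, and — for `Π^temp_{Y_L}` — `IsTempered` plus
the tower input `htower₀` (from which T64-L02 = Lemma 6.3 (ii) and T64-L06′ = Lemma 6.3 (iii) at the
coverings follow: `piTempDFGIffDOF_of_tower`, `openDenseDOFConjugator_of_tower`).  Assembly:
`temperedAnabelianTheorem_of_inputs` (abc-iut-w5-d139). [cite: MochizukiSemiAnbd2006, Thm 6.4 pp.70-71] -/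
theorem temperedAnabelianTheorem_of_tower {X Y : TemperedCurve p} (C : TemperedCurveHom p X Y)
    (h01 : GeometricIsDFG C) (h01b : GeometricIsGaloisCompatible C) (h04 : ProfiniteAnabelianTheorem C)
    (hT : IsTempered Y.PiTemp)
    (htower₀ : ∀ U ∈ 𝓝 (1 : Y.PiTemp), ∃ N : OpenNormalSubgroup Y.PiTemp, (N : Set Y.PiTemp) ⊆ U ∧
      ∃ (G : Subgroup (Y.PiTemp ⧸ N.toSubgroup)) (_ : IsFreeGroup G), G.Normal ∧ G.FiniteIndex ∧
        Finite (IsFreeGroup.Generators G) ∧ ∃ a ∈ G, ∃ b ∈ G, a * b ≠ b * a) :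
    TemperedAnabelianTheorem C :=
  temperedAnabelianTheorem_of_inputs C h01 h01b (Y.piTempDFGIffDOF_of_tower htower₀) h04
    (Y.openDenseDOFConjugator_of_tower hT htower₀)

end TemperedCurve

namespace TemperedMorphismOrigin

variable {p : ℕ} [Fact p.Prime]

/-- **[SemiAnbd] Theorem 6.4 as printed** (origin-quantified, `Ω.TemperedAnabelianTheoremHolds`), modulo:
the `π₁^temp`-functor clauses and [Mzk8] Thm. 1.2 for certified dominant morphisms (`hfun`), and — for
every certified `Y` — `IsTempered Y.PiTemp` with the tower input ([André] §4.5) (`htw`).  Lemma 6.3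
(ii)/(iii) are no longer inputs. [cite: MochizukiSemiAnbd2006, Thm 6.4 pp.70-71] -/
theorem temperedAnabelianTheoremHolds_of_tower (Ω : TemperedMorphismOrigin p)
    (hfun : ∀ (X Y : TemperedCurve p) (C : TemperedCurveHom p X Y), Ω.IsHyperbolicCurveOrigin X →
      Ω.IsHyperbolicCurveOrigin Y → Ω.IsDomHomOrigin C →
        TemperedCurve.GeometricIsDFG C ∧ TemperedCurve.GeometricIsGaloisCompatible C ∧
          TemperedCurve.ProfiniteAnabelianTheorem C)
    (htw : ∀ Y : TemperedCurve p, Ω.IsHyperbolicCurveOrigin Y → IsTempered Y.PiTemp ∧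
      ∀ U ∈ 𝓝 (1 : Y.PiTemp), ∃ N : OpenNormalSubgroup Y.PiTemp, (N : Set Y.PiTemp) ⊆ U ∧
        ∃ (G : Subgroup (Y.PiTemp ⧸ N.toSubgroup)) (_ : IsFreeGroup G), G.Normal ∧ G.FiniteIndex ∧
          Finite (IsFreeGroup.Generators G) ∧ ∃ a ∈ G, ∃ b ∈ G, a * b ≠ b * a) :
    Ω.TemperedAnabelianTheoremHolds := by
  intro X Y C hX hY hC
  obtain ⟨h01, h01b, h04⟩ := hfun X Y C hX hY hC
  obtain ⟨hT, htower₀⟩ := htw Y hY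
  exact TemperedCurve.temperedAnabelianTheorem_of_tower C h01 h01b h04 hT htower₀

end TemperedMorphismOrigin

end Literature.AnabelianGeometry.SemiGraphs

end
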